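import Summits.ResolutionOfSingularities.ResolutionOfSingularities.Theorems.PurelyInseparableDim4StrictTransformBlowup
import Literature.AlgebraicGeometry.Resolution.PointCentrePermissible
import HarnessLib
import HarnessLib.Audit.Tags

/-!
# Purely inseparable dim 4 — (M-c) at a CLOSED POINT: `V(τᶜ(𝓗, ord_x 𝓗)) ⟶ V(𝓗)` is `Bl_x V(𝓗)`

Sequel of `PurelyInseparableDim4StrictTransformBlowup` ((M-c) of the E2(3,3) transfer row, p666342).  The centre of the
cell's tower (p-2 g2's (M-a) `globalModel`) is a CLOSED POINT `x_i` of a regular ambient and the marked ideal is carried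
by `MarkedIdeal.transform` (controlled transform with weight `M.mult`); this file specialises (M-c) to that shape:

* `interior_singleton_eq_empty_of_not_isOpen` — a non-open point is nowhere dense;
* **`isBlowup_subscheme_controlledTransform_point`** — `X` locally Noetherian regular, `x` a closed non-open point,
  `π` a blow-up of `X` at `x` (centre `vanishingIdeal {x}`), `𝓗` an effective Cartier divisor with `ord_x 𝓗 = m`:
  every morphism `V(τᶜ(𝓗, m)) ⟶ V(𝓗)` over `π` is a blow-up of `V(𝓗)` along `𝓘_x|_{V(𝓗)}`; `exists_…` form;
* **`exists_isBlowup_subscheme_transform_point`** — the same for a marked ideal `M` with `ord_x M.ideal = M.mult`: the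
  subscheme of `(M.transform π 𝓘_x).ideal` is the blow-up of `V(M.ideal)` at `x` (`MarkedIdeal.transform_ideal` is `rfl`).

Regularity of the reduced point (`isRegular_subscheme_vanishingIdeal_singleton`), its support
(`Scheme.IdealSheafData.coe_support_vanishingIdeal`) and its generic point (`isGenericPoint_def`) are tree / Mathlib facts.
[cite: Kollar2007, 3.30.2] [cite: BierstoneGrigorievMilmanWlodarczyk2011, §4 Remark (3)]
OURS · counted 0 · nothing here proves `ModelRow`, E2(3,3), `NoIsolatedTrap 3 3`, or resolution of singularities in
dimension `≥ 4` / characteristic `p`.  Supports stmt-ResolutionOfSingularities-16155 (helper).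
bears_on: LADDER-RESOLUTION:D157-DOOR2 (res-dim4-pi · E2 dictionary · (M-c) point centre).
-/

set_option linter.dupNamespace false -- mandated namespace of this single-conjunct summit

noncomputable section

open CategoryTheory CategoryTheory.Limits AlgebraicGeometry TopologicalSpace IsLocalRing
open Literature.AlgebraicGeometry.Resolution
open Scheme.IdealSheafData (vanishingIdeal)

namespace Summit.ResolutionOfSingularities.ResolutionOfSingularities.Theorems.PIDim4

namespace StrictTransformBlowup

universe u

/-- A non-open singleton has empty interior. [folklore] -/
theorem interior_singleton_eq_empty_of_not_isOpen {α : Type*} [TopologicalSpace α] {x : α}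
    (h : ¬ IsOpen ({x} : Set α)) : interior ({x} : Set α) = ∅ := by
  rcases (Set.subset_singleton_iff_eq.mp (interior_subset : interior ({x} : Set α) ⊆ {x})) with h0 | h1
  · exact h0
  · exact absurd (h1 ▸ isOpen_interior) h

section Point

variable {X X' : Scheme.{u}} {π : X' ⟶ X} {𝓗 : X.IdealSheafData} {x : X} {m : ℕ}

/-- **(M-c) at a closed point.**  `X` locally Noetherian and regular, `x` a closed point which is not open, `π` a
blow-up of `X` at `x`, `𝓗` an effective Cartier divisor with `ord_x 𝓗 = m`: every morphism `V(τᶜ(𝓗, m)) ⟶ V(𝓗)` over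
`π` is a blow-up of the hypersurface `V(𝓗)` along `𝓘_x|_{V(𝓗)}`. [cite: Kollar2007, 3.30.2]
[cite: BierstoneGrigorievMilmanWlodarczyk2011, §4 Remark (3)] -/
theorem isBlowup_subscheme_controlledTransform_point [IsLocallyNoetherian X] (hX : Scheme.IsRegular X)
    (hx : IsClosed ({x} : Set X)) (hopen : ¬ IsOpen ({x} : Set X))
    (hπ : IsBlowup π (vanishingIdeal (⟨{x}, hx⟩ : Closeds X))) (h𝓗 : IsEffectiveCartier 𝓗)
    (hm : idealOrder 𝓗 x = m)
    (πS : (controlledTransform π (vanishingIdeal (⟨{x}, hx⟩ : Closeds X)) 𝓗 m).subscheme ⟶ 𝓗.subscheme)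
    (hπS : πS ≫ 𝓗.subschemeι =
      (controlledTransform π (vanishingIdeal (⟨{x}, hx⟩ : Closeds X)) 𝓗 m).subschemeι ≫ π) :
    IsBlowup πS ((vanishingIdeal (⟨{x}, hx⟩ : Closeds X)).comap 𝓗.subschemeι) := by
  have hsupp : ((vanishingIdeal (⟨{x}, hx⟩ : Closeds X)).support : Set X) = {x} :=
    Scheme.IdealSheafData.coe_support_vanishingIdeal _
  have hη : IsGenericPoint x ((vanishingIdeal (⟨{x}, hx⟩ : Closeds X)).support : Set X) := by
    rw [hsupp, isGenericPoint_def, hx.closure_eq]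
  have hint : interior ((vanishingIdeal (⟨{x}, hx⟩ : Closeds X)).support : Set X) = ∅ := by
    rw [hsupp]
    exact interior_singleton_eq_empty_of_not_isOpen hopen
  exact isBlowup_subscheme_controlledTransform_of_idealOrder_eq hX hπ
    (isRegular_subscheme_vanishingIdeal_singleton hx) hη hint h𝓗 hm πS hπS

/-- **(M-c) at a closed point, existence form.** [cite: Kollar2007, 3.30.2] -/
theorem exists_isBlowup_subscheme_controlledTransform_point [IsLocallyNoetherian X] (hX : Scheme.IsRegular X)
    (hx : IsClosed ({x} : Set X)) (hopen : ¬ IsOpen ({x} : Set X))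
    (hπ : IsBlowup π (vanishingIdeal (⟨{x}, hx⟩ : Closeds X))) (h𝓗 : IsEffectiveCartier 𝓗)
    (hm : idealOrder 𝓗 x = m) :
    ∃ πS : (controlledTransform π (vanishingIdeal (⟨{x}, hx⟩ : Closeds X)) 𝓗 m).subscheme ⟶ 𝓗.subscheme,
      πS ≫ 𝓗.subschemeι =
          (controlledTransform π (vanishingIdeal (⟨{x}, hx⟩ : Closeds X)) 𝓗 m).subschemeι ≫ π ∧
        IsBlowup πS ((vanishingIdeal (⟨{x}, hx⟩ : Closeds X)).comap 𝓗.subschemeι) := by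
  obtain ⟨πS, hπS⟩ :=
    exists_hom_subscheme_controlledTransform_weight π (vanishingIdeal (⟨{x}, hx⟩ : Closeds X)) 𝓗 m
  exact ⟨πS, hπS, isBlowup_subscheme_controlledTransform_point hX hx hopen hπ h𝓗 hm πS hπS⟩

/-- **(M-c) for a MARKED ideal at a closed point** (the shape of the cell's model: `M (i+1) = (M i).transform (π i) 𝓘_{x i}`,
`(M i).mult = 3 = ord_{x_i} (M i).ideal`): if `ord_x M.ideal = M.mult` then the subscheme of the transformed marked
ideal `(M.transform π 𝓘_x).ideal` (= `τᶜ(M.ideal, M.mult)`, `MarkedIdeal.transform_ideal`) is a blow-up of `V(M.ideal)`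
at `x`. [cite: Kollar2007, 3.30.2] -/
theorem exists_isBlowup_subscheme_transform_point [IsLocallyNoetherian X] (hX : Scheme.IsRegular X)
    (hx : IsClosed ({x} : Set X)) (hopen : ¬ IsOpen ({x} : Set X))
    (hπ : IsBlowup π (vanishingIdeal (⟨{x}, hx⟩ : Closeds X))) (M : MarkedIdeal X)
    (hM : IsEffectiveCartier M.ideal) (hm : idealOrder M.ideal x = M.mult) :
    ∃ πS : ((M.transform π (vanishingIdeal (⟨{x}, hx⟩ : Closeds X))).ideal).subscheme ⟶ M.ideal.subscheme,
      πS ≫ M.ideal.subschemeι =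
          ((M.transform π (vanishingIdeal (⟨{x}, hx⟩ : Closeds X))).ideal).subschemeι ≫ π ∧
        IsBlowup πS ((vanishingIdeal (⟨{x}, hx⟩ : Closeds X)).comap M.ideal.subschemeι) :=
  exists_isBlowup_subscheme_controlledTransform_point hX hx hopen hπ hM hm

end Point

end StrictTransformBlowup

end Summit.ResolutionOfSingularities.ResolutionOfSingularities.Theorems.PIDim4

end
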